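import Summits.AtomisticToContinuum.HydrodynamicLimit.Theorems.EquilibriumClampedCollisionalWindowLD.Negative.Energy
import Summits.AtomisticToContinuum.HydrodynamicLimit.Theorems.EquilibriumClampedCollisionalWindowLD.Negative.Gibbs
import Summits.AtomisticToContinuum.HydrodynamicLimit.Theorems.EquilibriumClampedCollisionalWindowLD.Negative.Concrete

/-!
# The clamp activity is small; the A-functional is small; the main lower bound on the labelled events (helper file of the refutation of `EquilibriumClampedCollisionalWindowLD`, stmt-AtomisticToContinuum-13733; see `Cruxes/EquilibriumClampedCollisionalWindowLD/Disproof.lean` and the evidence WITNESS.md; no Theses declaration is asserted positively; refuter-cdisprove-stmt-AtomisticToContinuum-13733-0)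
-/

noncomputable section

open Real
open scoped InnerProductSpace

namespace Summit.AtomisticToContinuum.HydrodynamicLimit.Theorems

namespace EquilibriumClampedCollisionalWindowLDNegative

section MainBound

open MeasureTheory Literature.Analysis.FluidPDE Literature.Analysis.FunctionSpaces Literature.MathematicalPhysics.KineticTheory
open Filter
open scoped Topology

namespace Lat

variable {Λ : Lat} {N : ℕ} {a : Fin (N + 1) ≃ Λ.Slot}
variable {Φ : HardSphereFlow (Torus.geometry (Fin 3)) Λ.P.ε (N + 1)}

/-! ### The clamp activity along the certificate -/

/-- A transfer is determined by its first sphere. [folklore] -/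
theorem sphI_inj (hΛ : Λ.OK) {z : Cfg N} {tr tr' : ℕ × (Fin Λ.n × Fin Λ.n) × ℕ} (htr : tr ∈ Λ.transfers a z)
    (htr' : tr' ∈ Λ.transfers a z) (h : Λ.sphI a tr = Λ.sphI a tr') : tr = tr' := by
  obtain ⟨f1, f2, f3⟩ := sphI_facts hΛ htr
  obtain ⟨f1', f2', f3'⟩ := sphI_facts hΛ htr'
  rw [h] at f1 f2 f3
  exact Prod.ext (f1.symm.trans f1') (Prod.ext (f3.symm.trans f3') (f2.symm.trans f2'))

/-- A transfer is determined by its second sphere. [folklore] -/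
theorem sphJ_inj (hΛ : Λ.OK) {z : Cfg N} {tr tr' : ℕ × (Fin Λ.n × Fin Λ.n) × ℕ} (htr : tr ∈ Λ.transfers a z)
    (htr' : tr' ∈ Λ.transfers a z) (h : Λ.sphJ a tr = Λ.sphJ a tr') : tr = tr' := by
  obtain ⟨f1, f2, f3⟩ := sphJ_facts hΛ htr
  obtain ⟨f1', f2', f3'⟩ := sphJ_facts hΛ htr'
  rw [h] at f1 f2 f3
  exact Prod.ext (f1.symm.trans f1') (Prod.ext (f3.symm.trans f3') (by have := f2.symm.trans f2'; omega))

/-- The impulse of a transfer is at most `Vhi`. [folklore] -/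
theorem trC_le (hΛ : Λ.OK) {z : Cfg N} (hz : z ∈ Λ.Ev a) {tr : ℕ × (Fin Λ.n × Fin Λ.n) × ℕ}
    (htr : tr ∈ Λ.transfers a z) : 0 ≤ Λ.trC a z tr ∧ Λ.trC a z tr ≤ Λ.P.Vhi := by
  have hP := hΛ.sep.adm
  obtain ⟨hb, hj, hact, -⟩ := mem_transfers.1 htr
  have hD := dataOK_of_mem hΛ hz hact tr.2.1
  have hf := stepFacts hP hD (by omega : tr.2.2 + 1 ≤ Λ.P.K)
  exact ⟨(hP.clo_pos.trans_le hf.cont.c_ge).le, hf.cont.c_le.trans hf.geom.U_le⟩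

/-- A sum of impulses over the transfers having a given first (or second) sphere is `≤ Vhi`. -/
theorem sum_ite_le (hΛ : Λ.OK) {z : Cfg N} (hz : z ∈ Λ.Ev a) (f : (ℕ × (Fin Λ.n × Fin Λ.n) × ℕ) → Fin (N + 1))
    (hf : ∀ tr ∈ Λ.transfers a z, ∀ tr' ∈ Λ.transfers a z, f tr = f tr' → tr = tr') (p : Fin (N + 1)) :
    ∑ tr ∈ Λ.transfers a z, (if f tr = p then Λ.trC a z tr else 0) ≤ Λ.P.Vhi := by
  classical
  rw [← Finset.sum_filter]
  have hcard : ((Λ.transfers a z).filter fun tr => f tr = p).card ≤ 1 := by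
    refine Finset.card_le_one.2 fun tr htr tr' htr' => ?_
    rw [Finset.mem_filter] at htr htr'
    exact hf tr htr.1 tr' htr'.1 (htr.2.trans htr'.2.symm)
  have hVhi := hΛ.sep.adm.Vhi_pos
  calc ∑ tr ∈ (Λ.transfers a z).filter (fun tr => f tr = p), Λ.trC a z tr
      ≤ ∑ tr ∈ (Λ.transfers a z).filter (fun tr => f tr = p), Λ.P.Vhi :=
        Finset.sum_le_sum fun tr htr => (trC_le hΛ hz (Finset.mem_filter.1 htr).1).2
    _ = ((Λ.transfers a z).filter fun tr => f tr = p).card • Λ.P.Vhi := Finset.sum_const _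
    _ ≤ Λ.P.Vhi := by
        rw [nsmul_eq_mul]
        rcases Nat.le_one_iff_eq_zero_or_eq_one.1 hcard with h | h <;> rw [h] <;> simp [hVhi.le]

/-- **The clamp activity is small**: the windowed momentum-impulse sum of any sphere is `≤ 2 Vhi`
(each sphere takes part in at most two transfers). [folklore] -/
theorem impulseSum_le (hW : Λ.WinOK) (hε : Λ.P.ε < 1 / 2) {z : Cfg N} (hz : z ∈ Λ.Ev a) (hgood : z ∈ Φ.good)
    (p : Fin (N + 1)) :
    0 ≤ Φ.collisionSum (Set.Ioc 0 Λ.w) (fun c => if c.fst = p then ‖c.postVel.1 - c.preVel.1‖ else 0) z ∧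
    Φ.collisionSum (Set.Ioc 0 Λ.w) (fun c => if c.fst = p then ‖c.postVel.1 - c.preVel.1‖ else 0) z ≤
      2 * Λ.P.Vhi := by
  classical
  have hΛ := hW.ok
  rw [collisionSum_window hW hε hz hgood]
  have hrw : ∀ tr ∈ Λ.transfers a z,
      ((if (HardSphereCollisionRecord.ofConfig (Torus.geometry (Fin 3)) Λ.P.ε (Λ.cert a z (Λ.ttime a z tr))
            (Λ.ttime a z tr) (Λ.sphI a tr) (Λ.sphJ a tr)).fst = p then
          ‖(HardSphereCollisionRecord.ofConfig (Torus.geometry (Fin 3)) Λ.P.ε (Λ.cert a z (Λ.ttime a z tr))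
            (Λ.ttime a z tr) (Λ.sphI a tr) (Λ.sphJ a tr)).postVel.1 -
            (HardSphereCollisionRecord.ofConfig (Torus.geometry (Fin 3)) Λ.P.ε (Λ.cert a z (Λ.ttime a z tr))
            (Λ.ttime a z tr) (Λ.sphI a tr) (Λ.sphJ a tr)).preVel.1‖ else 0) +
       (if (HardSphereCollisionRecord.ofConfig (Torus.geometry (Fin 3)) Λ.P.ε (Λ.cert a z (Λ.ttime a z tr))
            (Λ.ttime a z tr) (Λ.sphJ a tr) (Λ.sphI a tr)).fst = p then
          ‖(HardSphereCollisionRecord.ofConfig (Torus.geometry (Fin 3)) Λ.P.ε (Λ.cert a z (Λ.ttime a z tr))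
            (Λ.ttime a z tr) (Λ.sphJ a tr) (Λ.sphI a tr)).postVel.1 -
            (HardSphereCollisionRecord.ofConfig (Torus.geometry (Fin 3)) Λ.P.ε (Λ.cert a z (Λ.ttime a z tr))
            (Λ.ttime a z tr) (Λ.sphJ a tr) (Λ.sphI a tr)).preVel.1‖ else 0)) =
      (if Λ.sphI a tr = p then Λ.trC a z tr else 0) + (if Λ.sphJ a tr = p then Λ.trC a z tr else 0) := by
    intro tr htr
    obtain ⟨h1, h2⟩ := impulse_transfer hW hz htr
    simp only [HardSphereCollisionRecord.ofConfig_fst]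
    rw [h1, h2]
  rw [Finset.sum_congr rfl hrw, Finset.sum_add_distrib]
  constructor
  · refine add_nonneg (Finset.sum_nonneg fun tr htr => ?_) (Finset.sum_nonneg fun tr htr => ?_) <;>
      split_ifs <;> first | exact (trC_le hΛ hz htr).1 | exact le_rfl
  · have h1 := sum_ite_le hΛ hz (Λ.sphI a) (fun tr htr tr' htr' h => sphI_inj hΛ htr htr' h) p
    have h2 := sum_ite_le hΛ hz (Λ.sphJ a) (fun tr htr tr' htr' h => sphJ_inj hΛ htr htr' h) p
    linarith

/-! ### The A-functional is small -/

/-- **One fast sphere per block**: the total speed along the certificate. [folklore] -/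
theorem velSum_le (hW : Λ.WinOK) {z : Cfg N} (hz : z ∈ Λ.Ev a) {r : ℝ} (hr0 : 0 ≤ r) (hrw : r ≤ Λ.w) :
    ∑ p : Fin (N + 1), ‖Λ.certVel a z r p‖ ≤
      ((Λ.Q * (Λ.n * Λ.n) : ℕ) : ℝ) * Λ.P.Vhi + ((N : ℝ) + 1) * max Λ.P.u Λ.P.ρs := by
  classical
  have hΛ := hW.ok
  have hP := hΛ.sep.adm
  -- the carrier index of each active block at time `r`
  have hex : ∀ b (ℓ : Fin Λ.n × Fin Λ.n), Λ.Active b → ∃ j, j ≤ Λ.P.K ∧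
      ‖vel Λ.P (bv 0) (Λ.bdata a z b ℓ) j r‖ ≤ Λ.P.Vhi ∧
      ∀ k, k ≤ Λ.P.K → k ≠ j → ‖vel Λ.P (bv 0) (Λ.bdata a z b ℓ) k r‖ ≤ max Λ.P.u Λ.P.ρs :=
    fun b ℓ hb => exists_carrier hP (dataOK_of_mem hΛ hz hb ℓ) hr0 (hrw.trans_lt (w_lt_tHit hW hz hb ℓ))
  let jc : ℕ → (Fin Λ.n × Fin Λ.n) → ℕ := fun b ℓ => if hb : Λ.Active b then Classical.choose (hex b ℓ hb) else 0
  have hjc : ∀ b ℓ (hb : Λ.Active b), jc b ℓ = Classical.choose (hex b ℓ hb) := fun b ℓ hb => dif_pos hb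
  -- pointwise bound
  have hpt : ∀ p : Fin (N + 1), ‖Λ.certVel a z r p‖ ≤
      Λ.P.Vhi * (if Λ.Active (Λ.blk (a p)) ∧ Λ.loc (a p) = jc (Λ.blk (a p)) (a p).2 then 1 else 0) +
        max Λ.P.u Λ.P.ρs := by
    intro p
    have hmax0 : 0 ≤ max Λ.P.u Λ.P.ρs := le_max_of_le_left hP.u_nn
    by_cases hb : Λ.Active (Λ.blk (a p))
    · rw [certVel_active z r p hb]
      have hspec := Classical.choose_spec (hex (Λ.blk (a p)) (a p).2 hb)
      rw [← hjc _ _ hb] at hspec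
      by_cases hl : Λ.loc (a p) = jc (Λ.blk (a p)) (a p).2
      · rw [if_pos ⟨hb, hl⟩, hl, mul_one]
        linarith [hspec.2.1]
      · rw [if_neg (fun h => hl h.2), mul_zero, zero_add]
        exact hspec.2.2 _ (loc_le_K hΛ (a p)) hl
    · rw [certVel_parked z r p hb, if_neg (fun h => hb h.1), mul_zero, zero_add]
      have := (hz p).2
      rw [drv_of_not_active hb, sub_zero] at this
      exact this.trans (le_max_left _ _)
  -- count the carriers
  have hcount : ∑ p : Fin (N + 1), (if Λ.Active (Λ.blk (a p)) ∧ Λ.loc (a p) = jc (Λ.blk (a p)) (a p).2 then (1 : ℝ) else 0)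
      ≤ ((Λ.Q * (Λ.n * Λ.n) : ℕ) : ℝ) := by
    rw [Finset.sum_boole]
    have : ((Finset.univ : Finset (Fin (N + 1))).filter fun p =>
        Λ.Active (Λ.blk (a p)) ∧ Λ.loc (a p) = jc (Λ.blk (a p)) (a p).2).card ≤ Λ.Q * (Λ.n * Λ.n) := by
      have hcard : ((Finset.range Λ.Q) ×ˢ (Finset.univ : Finset (Fin Λ.n × Fin Λ.n))).card = Λ.Q * (Λ.n * Λ.n) := by
        simp [Finset.card_product, Finset.card_univ, Fintype.card_prod, Fintype.card_fin]
      rw [← hcard]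
      refine Finset.card_le_card_of_injOn (fun p => (Λ.blk (a p), (a p).2)) ?_ ?_
      · intro p hp
        simp only [Finset.coe_filter, Finset.mem_univ, true_and, Set.mem_setOf_eq] at hp
        simp only [Finset.coe_product, Finset.coe_range, Finset.coe_univ, Set.mem_prod, Set.mem_Iio, Set.mem_univ,
          and_true]
        exact hp.1.1
      · intro p hp q hq hpq
        simp only [Finset.coe_filter, Finset.mem_univ, true_and, Set.mem_setOf_eq] at hp hq
        simp only [Prod.mk.injEq] at hpq
        apply a.injective
        have hl : Λ.loc (a p) = Λ.loc (a q) := by rw [hp.2, hq.2, hpq.1, hpq.2]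
        have h1 := Λ.blk_mul_add_loc (a p)
        have h2 := Λ.blk_mul_add_loc (a q)
        exact Prod.ext (Fin.ext (by rw [← h1, ← h2, hpq.1, hl])) hpq.2
    exact_mod_cast this
  calc ∑ p : Fin (N + 1), ‖Λ.certVel a z r p‖
      ≤ ∑ p : Fin (N + 1), (Λ.P.Vhi * (if Λ.Active (Λ.blk (a p)) ∧ Λ.loc (a p) = jc (Λ.blk (a p)) (a p).2 then 1 else 0) +
          max Λ.P.u Λ.P.ρs) := Finset.sum_le_sum fun p _ => hpt p
    _ = Λ.P.Vhi * ∑ p : Fin (N + 1), (if Λ.Active (Λ.blk (a p)) ∧ Λ.loc (a p) = jc (Λ.blk (a p)) (a p).2 then (1 : ℝ) else 0) +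
          ((N : ℝ) + 1) * max Λ.P.u Λ.P.ρs := by
        rw [Finset.sum_add_distrib, Finset.mul_sum, Finset.sum_const, Finset.card_univ, Fintype.card_fin, nsmul_eq_mul]
        push_cast; ring
    _ ≤ _ := by
        have := mul_le_mul_of_nonneg_left hcount hP.Vhi_pos.le
        linarith

/-- The `A`-functional integrand of the energy row at `u₀ = 0`, `θ₀ = 1` (general `Z, Z'`). -/
def aeIntegrand (σ Z Z' : ℝ) (zr : Cfg N) : ℝ :=
  ∑ i, ((∑ l, (0 : E3) l * Torus.partialDeriv l phi (zr i).1) * (1 * σ ^ 3 * Z' + (1 / 3) * (Z - 1) * ‖(zr i).2 - 0‖ ^ 2) +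
    1 * (Z - 1) * (∑ l, Torus.partialDeriv l phi (zr i).1 * ((zr i).2 - 0) l))

/-- Pointwise bound of the `A`-integrand by the total speed. [folklore] -/
theorem abs_aeIntegrand_le (σ Z Z' : ℝ) (zr : Cfg N) :
    |aeIntegrand σ Z Z' zr| ≤ |Z - 1| * (6 * Real.pi) * ∑ i, ‖(zr i).2‖ := by
  unfold aeIntegrand
  have hzero : ∀ i : Fin (N + 1), (∑ l, (0 : E3) l * Torus.partialDeriv l phi (zr i).1) = 0 := by
    intro i; simp
  simp only [hzero, zero_mul, zero_add, one_mul, sub_zero]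
  rw [Finset.mul_sum]
  refine (Finset.abs_sum_le_sum_abs _ _).trans (Finset.sum_le_sum fun i _ => ?_)
  rw [abs_mul, mul_assoc]
  refine mul_le_mul_of_nonneg_left (α := ℝ) ?_ (abs_nonneg _)
  calc |∑ l, Torus.partialDeriv l phi (zr i).1 * (zr i).2 l|
      ≤ ∑ l, |Torus.partialDeriv l phi (zr i).1 * (zr i).2 l| := Finset.abs_sum_le_sum_abs _ _
    _ ≤ ∑ _l : Fin 3, 2 * Real.pi * ‖(zr i).2‖ := by
        refine Finset.sum_le_sum fun l _ => ?_
        rw [abs_mul]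
        exact mul_le_mul (abs_partialDeriv_phi_le l _) (abs_apply_le_norm _ l) (abs_nonneg _) (by positivity)
    _ = 6 * Real.pi * ‖(zr i).2‖ := by simp [Finset.sum_const, Finset.card_univ, Fintype.card_fin]; ring

/-- **The `A`-functional is small**: along the flow (= certificate) on the window. [folklore] -/
theorem abs_Ae_le (hW : Λ.WinOK) {z : Cfg N} (hz : z ∈ Λ.Ev a) (hgood : z ∈ Φ.good) (σ Z Z' : ℝ) :
    |∫ r in (0 : ℝ)..Λ.w, aeIntegrand σ Z Z' (Φ.flow r z)| ≤
      |Z - 1| * (6 * Real.pi) * (((Λ.Q * (Λ.n * Λ.n) : ℕ) : ℝ) * Λ.P.Vhi + ((N : ℝ) + 1) * max Λ.P.u Λ.P.ρs) * Λ.w := by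
  have hw := hW.w_nn
  have h := intervalIntegral.norm_integral_le_of_norm_le_const (a := (0 : ℝ)) (b := Λ.w)
    (f := fun r => aeIntegrand σ Z Z' (Φ.flow r z))
    (C := |Z - 1| * (6 * Real.pi) * (((Λ.Q * (Λ.n * Λ.n) : ℕ) : ℝ) * Λ.P.Vhi + ((N : ℝ) + 1) * max Λ.P.u Λ.P.ρs)) ?_
  · rw [sub_zero, abs_of_nonneg hw] at h
    simpa [Real.norm_eq_abs] using h
  · intro r hr
    rw [Set.uIoc_of_le hw] at hr
    rw [Real.norm_eq_abs]
    have heq := flow_eqOn_cert hW hz Φ hgood ⟨hr.1.le, hr.2⟩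
    simp only at heq
    rw [heq]
    refine (abs_aeIntegrand_le σ Z Z' _).trans ?_
    refine mul_le_mul_of_nonneg_left ?_ (by positivity)
    have := velSum_le hW hz hr.1.le hr.2
    simp only [cert_snd]
    exact this

/-! ### The main lower bound on the labelled events -/

/-- The gain constant is nonnegative under `GainOK`. [folklore] -/
theorem gainT_nonneg (hΛ : Λ.OK) (hG : Λ.GainOK) : 0 ≤ gainT Λ.P := by
  have hP := hΛ.sep.adm
  have hαn1 : Λ.P.αn ≤ 1 := hΛ.sep.αn_le
  have hαn0 : 0 ≤ Λ.P.αn := hP.αn_nn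
  unfold gainT
  have h1 : 0 ≤ 2 - 4 * (2 * Real.pi * (Λ.P.errA + Λ.P.fwd) + Real.pi * Λ.P.ε) := by linarith [hG.h_le]
  have h2 : 0 ≤ Λ.P.ε * (1 - Λ.P.αn ^ 2 / 2) := mul_nonneg hP.ε_pos.le (by nlinarith)
  have h3 : 0 ≤ Λ.P.clo * (Λ.P.clo - 2 * Λ.P.u) := mul_nonneg hP.clo_pos.le (by linarith [hG.u_le])
  positivity

/-- The clamp activity functional of the statement (per sphere). -/
def actF (Λ : Lat) {N : ℕ} (Φ : HardSphereFlow (Torus.geometry (Fin 3)) Λ.P.ε (N + 1)) (κ : ℝ) (i : Fin (N + 1))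
    (z : Cfg N) : ℝ :=
  κ * Φ.collisionSum (Set.Ioc 0 Λ.w) (fun c => if c.fst = i then ‖c.postVel.1 - c.preVel.1‖ else 0) z

/-- The clamp weight of the statement. -/
def ωF (Λ : Lat) {N : ℕ} (Φ : HardSphereFlow (Torus.geometry (Fin 3)) Λ.P.ε (N + 1)) (κ V : ℝ) (i : Fin (N + 1))
    (z : Cfg N) : ℝ :=
  if Λ.actF Φ κ i z ≤ V then 1 else 0

/-- The energy functional `X^e` of the statement with the test function `φ = cos 2π x₀`. -/
def XeF (Λ : Lat) {N : ℕ} (Φ : HardSphereFlow (Torus.geometry (Fin 3)) Λ.P.ε (N + 1)) (κ V : ℝ) (z : Cfg N) : ℝ :=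
  Φ.collisionSum (Set.Ioc 0 Λ.w)
    (fun c => Λ.ωF Φ κ V c.fst z * Λ.ωF Φ κ V c.snd z *
      ((phi c.fstPos - phi c.sndPos) * ((‖c.postVel.1‖ ^ 2 - ‖c.preVel.1‖ ^ 2) / 2)) / 2) z

/-- The `A^e` functional of the statement at `u₀ = 0`, `θ₀ = 1`. -/
def AeF (Λ : Lat) {N : ℕ} (Φ : HardSphereFlow (Torus.geometry (Fin 3)) Λ.P.ε (N + 1)) (σ Z Z' : ℝ) (z : Cfg N) : ℝ :=
  ∫ r in (0 : ℝ)..Λ.w, aeIntegrand σ Z Z' (Φ.flow r z)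

/-- The clamp is inactive when `κ · 2 Vhi ≤ V` (`κ = σ/τ ≥ 0`). [folklore] -/
theorem ωF_eq_one (hW : Λ.WinOK) (hε : Λ.P.ε < 1 / 2) {z : Cfg N} {a : Fin (N + 1) ≃ Λ.Slot} (hz : z ∈ Λ.Ev a)
    (hgood : z ∈ Φ.good) {κ V : ℝ} (hκ : 0 ≤ κ) (hV : κ * (2 * Λ.P.Vhi) ≤ V) (i : Fin (N + 1)) :
    Λ.ωF Φ κ V i z = 1 := by
  unfold ωF actF
  rw [if_pos]
  obtain ⟨-, h2⟩ := impulseSum_le hW hε hz hgood i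
  exact (mul_le_mul_of_nonneg_left h2 hκ).trans hV

/-- **Pointwise exponent bound on a labelled event.** [folklore] -/
theorem exponent_ge (hW : Λ.WinOK) (hG : Λ.GainOK) (hε : Λ.P.ε < 1 / 2) (hw0 : 0 < Λ.w) {z : Cfg N}
    {a : Fin (N + 1) ≃ Λ.Slot} (hz : z ∈ Λ.Ev a) (hgood : z ∈ Φ.good) {κ V β σ Z Z' : ℝ} (hκ : 0 ≤ κ)
    (hV : κ * (2 * Λ.P.Vhi) ≤ V) (hβ : 0 ≤ β) {kw : ℕ} (hkK : kw + 1 ≤ Λ.P.K) (hkw : (kw : ℝ) * Λ.P.θhi ≤ Λ.w)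
    (hM : 24 * Λ.m ≤ Λ.M) :
    Λ.Fmin N kw β Z ≤ β * (Λ.w⁻¹ * Λ.XeF Φ κ V z - Λ.w⁻¹ * Λ.AeF Φ σ Z Z' z) := by
  classical
  have hΛ := hW.ok
  have hω : ∀ i, Λ.ωF Φ κ V i z = 1 := ωF_eq_one hW hε hz hgood hκ hV
  have hX := energy_lower hW hG hε hz hgood (ω := fun i => Λ.ωF Φ κ V i z) hω
  have hT : Λ.Tlow kw ≤ ((Λ.transfers a z).card : ℝ) := by
    have h1 := card_transfers_ge (a := a) hΛ hz hkK hkw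
    have h2 := card_active_ge Λ hΛ hM
    have h1' : ((((Finset.range Λ.Q).filter Λ.Active).card * (Λ.n * Λ.n) * kw : ℕ) : ℝ) ≤ (Λ.transfers a z).card := by
      exact_mod_cast h1
    push_cast at h1'
    unfold Tlow
    have : (0 : ℝ) ≤ (Λ.n : ℝ) * Λ.n * kw := by positivity
    nlinarith
  have hg0 := gainT_nonneg hΛ hG
  have hwi : 0 < Λ.w⁻¹ := inv_pos.2 hw0
  have hXe : Λ.w⁻¹ * (Λ.Tlow kw * gainT Λ.P) ≤ Λ.w⁻¹ * Λ.XeF Φ κ V z := by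
    refine mul_le_mul_of_nonneg_left ?_ hwi.le
    exact le_trans (mul_le_mul_of_nonneg_right hT hg0) hX
  have hA := abs_Ae_le hW hz hgood σ Z Z'
  have hAe : Λ.w⁻¹ * Λ.AeF Φ σ Z Z' z ≤
      |Z - 1| * (6 * Real.pi) * (((Λ.Q * (Λ.n * Λ.n) : ℕ) : ℝ) * Λ.P.Vhi + ((N : ℝ) + 1) * max Λ.P.u Λ.P.ρs) := by
    have h1 : Λ.AeF Φ σ Z Z' z ≤ |Z - 1| * (6 * Real.pi) *
        (((Λ.Q * (Λ.n * Λ.n) : ℕ) : ℝ) * Λ.P.Vhi + ((N : ℝ) + 1) * max Λ.P.u Λ.P.ρs) * Λ.w := (le_abs_self _).trans hA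
    calc Λ.w⁻¹ * Λ.AeF Φ σ Z Z' z ≤ Λ.w⁻¹ * (|Z - 1| * (6 * Real.pi) *
          (((Λ.Q * (Λ.n * Λ.n) : ℕ) : ℝ) * Λ.P.Vhi + ((N : ℝ) + 1) * max Λ.P.u Λ.P.ρs) * Λ.w) :=
          mul_le_mul_of_nonneg_left h1 hwi.le
      _ = _ := by field_simp
  unfold Fmin
  have := mul_le_mul_of_nonneg_left hXe hβ
  have := mul_le_mul_of_nonneg_left hAe hβ
  nlinarith

/-- **The main lower bound**: the exponential moment is at least `(N+1)! · e^{Fmin} · evB`. [folklore] -/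
theorem lintegral_ge (hcardN : Fintype.card Λ.Slot = N + 1) (hW : Λ.WinOK) (hG : Λ.GainOK) (hε : Λ.P.ε < 1 / 2)
    (hr : Λ.P.r < 1 / 2) (hw0 : 0 < Λ.w) {σ : ℝ} (hσ : σ ≤ 1 / 2) (hεσ : hsDiameter σ N = Λ.P.ε)
    (hgoodP : localGibbsMeasure σ (fun _ => 1) (fun _ => 0) (fun _ => (1 : ℝ)) N Φ.goodᶜ = 0)
    {κ V β Z Z' : ℝ} (hκ : 0 ≤ κ) (hV : κ * (2 * Λ.P.Vhi) ≤ V) (hβ : 0 ≤ β) {kw : ℕ} (hkK : kw + 1 ≤ Λ.P.K)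
    (hkw : (kw : ℝ) * Λ.P.θhi ≤ Λ.w) (hM : 24 * Λ.m ≤ Λ.M) :
    ENNReal.ofReal (((N + 1).factorial : ℝ) * Real.exp (Λ.Fmin N kw β Z) * Λ.evB N) ≤
      ∫⁻ z, ENNReal.ofReal (Real.exp (β * (Λ.w⁻¹ * Λ.XeF Φ κ V z - Λ.w⁻¹ * Λ.AeF Φ σ Z Z' z)))
        ∂(localGibbsMeasure σ (fun _ => 1) (fun _ => 0) (fun _ => (1 : ℝ)) N) := by
  classical
  set P := localGibbsMeasure σ (fun _ => 1) (fun _ => 0) (fun _ => (1 : ℝ)) N with hP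
  set f : Cfg N → ENNReal := fun z => ENNReal.ofReal (Real.exp (β * (Λ.w⁻¹ * Λ.XeF Φ κ V z - Λ.w⁻¹ * Λ.AeF Φ σ Z Z' z)))
  set c : ENNReal := ENNReal.ofReal (Real.exp (Λ.Fmin N kw β Z)) with hc
  -- Step 1: restrict to the disjoint union of the labelled events
  have hmeas : ∀ a : Fin (N + 1) ≃ Λ.Slot, MeasurableSet (Λ.Ev a : Set (Cfg N)) := fun a => measurableSet_Ev
  have hdisj : Pairwise (Function.onFun Disjoint fun a : Fin (N + 1) ≃ Λ.Slot => (Λ.Ev a : Set (Cfg N))) :=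
    fun a a' h => Ev_disjoint hW h
  have step1 : ∑ a : Fin (N + 1) ≃ Λ.Slot, ∫⁻ z in Λ.Ev a, f z ∂P ≤ ∫⁻ z, f z ∂P := by
    have h := lintegral_iUnion (μ := P) hmeas hdisj f
    rw [tsum_fintype] at h
    rw [← h]
    exact setLIntegral_le_lintegral _ _
  -- Step 2: on each event the integrand is at least `c` off the null set `goodᶜ`
  have step2 : ∀ a : Fin (N + 1) ≃ Λ.Slot, c * P (Λ.Ev a) ≤ ∫⁻ z in Λ.Ev a, f z ∂P := by
    intro a
    have hpt : ∀ z ∈ Λ.Ev a, (Φ.good).indicator (fun _ => c) z ≤ f z := by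
      intro z hz
      by_cases hg : z ∈ Φ.good
      · rw [Set.indicator_of_mem hg]
        exact ENNReal.ofReal_le_ofReal (Real.exp_le_exp.2
          (exponent_ge hW hG hε hw0 hz hg hκ hV hβ hkK hkw hM))
      · rw [Set.indicator_of_notMem hg]; exact bot_le
    calc c * P (Λ.Ev a) ≤ c * P (Φ.good ∩ Λ.Ev a) := by
          refine mul_le_mul' le_rfl ?_
          have hsub : (Λ.Ev a : Set (Cfg N)) ⊆ (Φ.good ∩ Λ.Ev a) ∪ Φ.goodᶜ := by
            intro z hz; by_cases hg : z ∈ Φ.good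
            · exact Or.inl ⟨hg, hz⟩
            · exact Or.inr hg
          calc P (Λ.Ev a) ≤ P ((Φ.good ∩ Λ.Ev a) ∪ Φ.goodᶜ) := measure_mono hsub
            _ ≤ P (Φ.good ∩ Λ.Ev a) + P Φ.goodᶜ := measure_union_le _ _
            _ = P (Φ.good ∩ Λ.Ev a) := by rw [hgoodP, add_zero]
      _ = ∫⁻ z in Λ.Ev a, (Φ.good).indicator (fun _ => c) z ∂P := by
          rw [lintegral_indicator_const Φ.measurableSet_good, Measure.restrict_apply Φ.measurableSet_good]
      _ ≤ ∫⁻ z in Λ.Ev a, f z ∂P := setLIntegral_mono' (hmeas a) hpt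
  -- Step 3: the uniform measure bound and the count of labellings
  have step3 : ∀ a : Fin (N + 1) ≃ Λ.Slot, c * ENNReal.ofReal (Λ.evB N) ≤ c * P (Λ.Ev a) := fun a =>
    mul_le_mul' le_rfl (measure_Ev_ge (a := a) hW hσ hεσ hr)
  have hcardE : Fintype.card (Fin (N + 1) ≃ Λ.Slot) = (N + 1).factorial := by
    have e : Fin (N + 1) ≃ Λ.Slot := Fintype.equivOfCardEq (by rw [Fintype.card_fin, hcardN])
    rw [Fintype.card_equiv e, Fintype.card_fin]
  calc ENNReal.ofReal (((N + 1).factorial : ℝ) * Real.exp (Λ.Fmin N kw β Z) * Λ.evB N)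
      = ((N + 1).factorial : ENNReal) * (c * ENNReal.ofReal (Λ.evB N)) := by
        rw [ENNReal.ofReal_mul (by positivity), ENNReal.ofReal_mul (by positivity), ENNReal.ofReal_natCast, hc,
          mul_assoc]
    _ = ∑ _a : Fin (N + 1) ≃ Λ.Slot, c * ENNReal.ofReal (Λ.evB N) := by
        rw [Finset.sum_const, Finset.card_univ, hcardE, nsmul_eq_mul]
    _ ≤ ∑ a : Fin (N + 1) ≃ Λ.Slot, ∫⁻ z in Λ.Ev a, f z ∂P :=
        Finset.sum_le_sum fun a _ => (step3 a).trans (step2 a)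
    _ ≤ _ := step1

end Lat

end MainBound

end EquilibriumClampedCollisionalWindowLDNegative

end Summit.AtomisticToContinuum.HydrodynamicLimit.Theorems

end
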